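import Summits.MatrixMultiplication.OmegaCensus.DominoZ5Z65Cell19
import Summits.MatrixMultiplication.OmegaCensus.ThreeSetZ5Z5Cells36
import Summits.MatrixMultiplication.OmegaCensus.DominoZ5Z5Cells
import Summits.MatrixMultiplication.OmegaCensus.DominoZ5Z5Part6
import Summits.MatrixMultiplication.OmegaCensus.DihedralLawModOneOrder25
import Summits.MatrixMultiplication.OmegaCensus.DihedralLawModOneOrder325Arith
import HarnessLib

/-!
# The `|A| ≡ 1 (mod 3)` law at `|A| = 325`: no law over `ℤ₅ × ℤ₆₅` (order 325 fully kernel, one theorem)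

ω-census `pub-omega`, family (b3), seat pub-omega-group gen 38.  Framing: lottery ticket; floor = certified bounds/negative ranges.
VALUE: ONE kernel theorem for the census line `|A| = 325` of the classification of dihedral-like groups attaining the law
`3|S||T||U| + 8 = 8|A|` (NR79: all cells of `ℤ₅ × ℤ₆₅` NONE, the last one `(1,9,12)` KERNEL this seat) — assembled, no new computation;
NOT progress on ω.

Proof of **`no_mod_one_law_z5_z65`**.  Every element of `A = ℤ₅ × ℤ₆₅` has order `≤ 65 < |A|/2`, so `A` is not two cosets of a cyclic
subgroup; hence (`two_cosets_of_mod_one_law_of_not_cube`) a law triple has cube coset parts `(s,s | t,t | u,u)` with `3stu + 1 = 325`,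
`stu = 108` (`cube_factor_of_325`: the `60` ordered factorisations).  Two parts `1` (`card_le_two_mul_addOrderOf_of_two_two_law`) or a
part `2` (`card_le_two_mul_addOrderOf_of_mod_one_law_card_four`, i.e. `cyclic_of_law_cube_two_pair`) again force an element of order
`≥ |A|/2`; the remaining shapes are the seven census cells `(1,3,36)`, `(1,4,27)` (`no_law_cube_1de_of_onto_z5z5`), `(1,6,18)`
(`no_law_cube_1de6_of_onto_z5z5`), `(1,9,12)` (`no_law_cube_one_nine_z5_z65`), `(3,3,12)`, `(3,4,9)` (`no_law_cube_three_three/four_z5_z65`),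
`(3,6,6)` (`no_law_cube_three_six_z5_z65`) in all orderings (`no_law_cube_two_parts_of_ordered`).
-/

namespace Summit.MatrixMultiplication.OmegaCensus

open Literature.Combinatorics.Additive Finset ZpZpDomino Z5Z5ThreeSet

/-! ## Assembly -/

section DihedralLike

variable {G : Type} [Group G] [DecidableEq G] {S T U : Finset G}

/-- **ORDER 325: no dihedral-like group over `ℤ₅ × ℤ₆₅` (any presentation constant `c₀`) has a TPP triple attaining the law
`3|S||T||U| + 8 = 8|A|`.**  Every one of the `60` ordered cube shapes `(s,s | t,t | u,u)`, `stu = 108`, and every non-cube shape is excluded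
by a kernel theorem of the census; this is the `|A| = 325` line of the classification 'law ⟹ an element of order `≥ |A|/2`' (the only
non-cyclic abelian group of order `325` is `ℤ₅ × ℤ₅ × ℤ₁₃ ≅ ℤ₅ × ℤ₆₅`). [folklore] -/
theorem no_mod_one_law_z5_z65 {ρ τ : ZMod 5 × ZMod 65 → G} {c₀ : ZMod 5 × ZMod 65}
    (hρρ : ∀ a b, ρ a * ρ b = ρ (a + b)) (hρτ : ∀ a b, ρ a * τ b = τ (b - a))
    (hτρ : ∀ a b, τ a * ρ b = τ (a + b)) (hττ : ∀ a b, τ a * τ b = ρ (c₀ + b - a))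
    (hρ : Function.Injective ρ) (hτ : Function.Injective τ) (hne : ∀ a b, ρ a ≠ τ b)
    (hsurj : ∀ g, (∃ a, ρ a = g) ∨ (∃ a, τ a = g)) (h : TripleProductProperty S T U) :
    3 * (S.card * T.card * U.card) + 8 ≠ 8 * Fintype.card (ZMod 5 × ZMod 65) := by
  intro hV
  have hA : Fintype.card (ZMod 5 × ZMod 65) = 325 := by rw [Fintype.card_prod, ZMod.card, ZMod.card]
  have h65 : ∀ q : ZMod 5 × ZMod 65, 65 • q = 0 := by
    intro q
    refine Prod.ext ?_ ?_
    · show 65 • q.1 = 0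
      rw [nsmul_eq_mul, show ((65 : ℕ) : ZMod 5) = 0 from by decide, zero_mul]
    · show 65 • q.2 = 0
      rw [nsmul_eq_mul, show ((65 : ℕ) : ZMod 65) = 0 from by decide, zero_mul]
  have big : ¬ ∃ g : ZMod 5 × ZMod 65, Fintype.card (ZMod 5 × ZMod 65) ≤ 2 * addOrderOf g := by
    rintro ⟨g, hg⟩
    have hle : addOrderOf g ≤ 65 := Nat.le_of_dvd (by norm_num) (addOrderOf_dvd_of_nsmul_eq_zero (h65 g))
    rw [hA] at hg
    omega
  have hmod : Fintype.card (ZMod 5 × ZMod 65) % 3 = 1 := by rw [hA]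
  have hA14 : 14 ≤ Fintype.card (ZMod 5 × ZMod 65) := by rw [hA]; norm_num
  have hA7 : 7 ≤ Fintype.card (ZMod 5 × ZMod 65) := by omega
  have hV_TUS : 3 * (T.card * U.card * S.card) + 8 = 8 * Fintype.card (ZMod 5 × ZMod 65) := by
    rw [show T.card * U.card * S.card = S.card * T.card * U.card by ring]; exact hV
  have hV_UST : 3 * (U.card * S.card * T.card) + 8 = 8 * Fintype.card (ZMod 5 × ZMod 65) := by
    rw [show U.card * S.card * T.card = S.card * T.card * U.card by ring]; exact hV
  have hTUS : TripleProductProperty T U S := h.rotate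
  have hUST : TripleProductProperty U S T := h.rotate.rotate
  by_cases hnc : ((univ.filter fun a : ZMod 5 × ZMod 65 => ρ a ∈ S).card = (univ.filter fun a : ZMod 5 × ZMod 65 => τ a ∈ S).card ∧
      (univ.filter fun a : ZMod 5 × ZMod 65 => ρ a ∈ T).card = (univ.filter fun a : ZMod 5 × ZMod 65 => τ a ∈ T).card ∧
      (univ.filter fun a : ZMod 5 × ZMod 65 => ρ a ∈ U).card = (univ.filter fun a : ZMod 5 × ZMod 65 => τ a ∈ U).card)
  · obtain ⟨hS', hT', hU'⟩ := hnc
    have cS := card_eq_parts' hρ hτ hne hsurj S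
    have cT := card_eq_parts' hρ hτ hne hsurj T
    have cU := card_eq_parts' hρ hτ hne hsurj U
    set s₀ := (univ.filter fun a : ZMod 5 × ZMod 65 => ρ a ∈ S).card with hs₀
    set t₀ := (univ.filter fun a : ZMod 5 × ZMod 65 => ρ a ∈ T).card with ht₀
    set u₀ := (univ.filter fun a : ZMod 5 × ZMod 65 => ρ a ∈ U).card with hu₀
    have eS : S.card = 2 * s₀ := by rw [cS, ← hS']; ring
    have eT : T.card = 2 * t₀ := by rw [cT, ← hT']; ring
    have eU : U.card = 2 * u₀ := by rw [cU, ← hU']; ring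
    have hprod : 3 * (s₀ * t₀ * u₀) + 1 = 325 := by
      rw [eS, eT, eU, hA] at hV; nlinarith
    rcases cube_factor_of_325 hprod with ⟨h1, h2, h3⟩ | ⟨h1, h2, h3⟩ | ⟨h1, h2, h3⟩ | ⟨h1, h2, h3⟩ | ⟨h1, h2, h3⟩ | ⟨h1, h2, h3⟩ | ⟨h1, h2, h3⟩ | ⟨h1, h2, h3⟩ | ⟨h1, h2, h3⟩ | ⟨h1, h2, h3⟩ | ⟨h1, h2, h3⟩ | ⟨h1, h2, h3⟩ | ⟨h1, h2, h3⟩ | ⟨h1, h2, h3⟩ | ⟨h1, h2, h3⟩ | ⟨h1, h2, h3⟩ | ⟨h1, h2, h3⟩ | ⟨h1, h2, h3⟩ | ⟨h1, h2, h3⟩ | ⟨h1, h2, h3⟩ | ⟨h1, h2, h3⟩ | ⟨h1, h2, h3⟩ | ⟨h1, h2, h3⟩ | ⟨h1, h2, h3⟩ | ⟨h1, h2, h3⟩ | ⟨h1, h2, h3⟩ | ⟨h1, h2, h3⟩ | ⟨h1, h2, h3⟩ | ⟨h1, h2, h3⟩ | ⟨h1, h2, h3⟩ | ⟨h1, h2,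 h3⟩ | ⟨h1, h2, h3⟩ | ⟨h1, h2, h3⟩ | ⟨h1, h2, h3⟩ | ⟨h1, h2, h3⟩ | ⟨h1, h2, h3⟩ | ⟨h1, h2, h3⟩ | ⟨h1, h2, h3⟩ | ⟨h1, h2, h3⟩ | ⟨h1, h2, h3⟩ | ⟨h1, h2, h3⟩ | ⟨h1, h2, h3⟩ | ⟨h1, h2, h3⟩ | ⟨h1, h2, h3⟩ | ⟨h1, h2, h3⟩ | ⟨h1, h2, h3⟩ | ⟨h1, h2, h3⟩ | ⟨h1, h2, h3⟩ | ⟨h1, h2, h3⟩ | ⟨h1, h2, h3⟩ | ⟨h1, h2, h3⟩ | ⟨h1, h2, h3⟩ | ⟨h1, h2, h3⟩ | ⟨h1, h2, h3⟩ | ⟨h1, h2, h3⟩ | ⟨h1, h2, h3⟩ | ⟨h1, h2, h3⟩ | ⟨h1, h2, h3⟩ | ⟨h1, h2, h3⟩ | ⟨h1, h2, h3⟩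
    · -- (1,1,108)
      exact big (card_le_two_mul_addOrderOf_of_two_two_law hρρ hρτ hτρ hττ hρ hτ hne hsurj hmod hA7 h (by rw [eS, h1]) (by rw [eT, h2]) hV)
    · -- (1,2,54)
      exact big (card_le_two_mul_addOrderOf_of_mod_one_law_card_four hρρ hρτ hτρ hττ hρ hτ hne hsurj hmod hA14 h hV (by rw [eT, h2]))
    · -- (1,3,36)
      exact absurd hV (no_law_cube_two_parts_of_ordered 1 3 (fun h' hS₀ hS₁ hT₀ hT₁ hU'' hV'' => no_law_cube_1de_of_onto_z5z5 (Or.inl rfl) hρρ hρτ hτρ hττ hρ hτ hne hsurj projZ5Z65 projZ5Z65_surjective h' hS₀ hS₁ hT₀ hT₁ hU'' hV'') h hS' hT' hU'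
        (Or.inl ⟨h1, h2⟩))
    · -- (1,4,27)
      exact absurd hV (no_law_cube_two_parts_of_ordered 1 4 (fun h' hS₀ hS₁ hT₀ hT₁ hU'' hV'' => no_law_cube_1de_of_onto_z5z5 (Or.inr rfl) hρρ hρτ hτρ hττ hρ hτ hne hsurj projZ5Z65 projZ5Z65_surjective h' hS₀ hS₁ hT₀ hT₁ hU'' hV'') h hS' hT' hU'
        (Or.inl ⟨h1, h2⟩))
    · -- (1,6,18)
      exact absurd hV (no_law_cube_two_parts_of_ordered 1 6 (fun h' hS₀ hS₁ hT₀ hT₁ hU'' hV'' => no_law_cube_1de6_of_onto_z5z5 rfl hρρ hρτ hτρ hττ hρ hτ hne hsurj projZ5Z65 projZ5Z65_surjective h' hS₀ hS₁ hT₀ hT₁ hU'' hV'') h hS' hT' hU'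
        (Or.inl ⟨h1, h2⟩))
    · -- (1,9,12)
      exact absurd hV (no_law_cube_one_nine_z5_z65 hρρ hρτ hτρ hττ hρ hτ hne hsurj h hS' hT' hU' (Or.inl ⟨h1, h2⟩))
    · -- (1,12,9)
      exact absurd hV (no_law_cube_one_nine_z5_z65 hρρ hρτ hτρ hττ hρ hτ hne hsurj h hS' hT' hU' (Or.inr (Or.inr (Or.inr (Or.inr (Or.inr (⟨h3, h1⟩)))))))
    · -- (1,18,6)
      exact absurd hV (no_law_cube_two_parts_of_ordered 1 6 (fun h' hS₀ hS₁ hT₀ hT₁ hU'' hV'' => no_law_cube_1de6_of_onto_z5z5 rfl hρρ hρτ hτρ hττ hρ hτ hne hsurj projZ5Z65 projZ5Z65_surjective h' hS₀ hS₁ hT₀ hT₁ hU'' hV'') h hS' hT' hU'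
        (Or.inr (Or.inr (Or.inr (Or.inr (Or.inr (⟨h3, h1⟩)))))))
    · -- (1,27,4)
      exact absurd hV (no_law_cube_two_parts_of_ordered 1 4 (fun h' hS₀ hS₁ hT₀ hT₁ hU'' hV'' => no_law_cube_1de_of_onto_z5z5 (Or.inr rfl) hρρ hρτ hτρ hττ hρ hτ hne hsurj projZ5Z65 projZ5Z65_surjective h' hS₀ hS₁ hT₀ hT₁ hU'' hV'') h hS' hT' hU'
        (Or.inr (Or.inr (Or.inr (Or.inr (Or.inr (⟨h3, h1⟩)))))))
    · -- (1,36,3)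
      exact absurd hV (no_law_cube_two_parts_of_ordered 1 3 (fun h' hS₀ hS₁ hT₀ hT₁ hU'' hV'' => no_law_cube_1de_of_onto_z5z5 (Or.inl rfl) hρρ hρτ hτρ hττ hρ hτ hne hsurj projZ5Z65 projZ5Z65_surjective h' hS₀ hS₁ hT₀ hT₁ hU'' hV'') h hS' hT' hU'
        (Or.inr (Or.inr (Or.inr (Or.inr (Or.inr (⟨h3, h1⟩)))))))
    · -- (1,54,2)
      exact big (card_le_two_mul_addOrderOf_of_mod_one_law_card_four hρρ hρτ hτρ hττ hρ hτ hne hsurj hmod hA14 hTUS hV_TUS (by rw [eU, h3]))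
    · -- (1,108,1)
      exact big (card_le_two_mul_addOrderOf_of_two_two_law hρρ hρτ hτρ hττ hρ hτ hne hsurj hmod hA7 hUST (by rw [eU, h3]) (by rw [eS, h1]) hV_UST)
    · -- (2,1,54)
      exact big (card_le_two_mul_addOrderOf_of_mod_one_law_card_four hρρ hρτ hτρ hττ hρ hτ hne hsurj hmod hA14 hUST hV_UST (by rw [eS, h1]))
    · -- (2,2,27)
      exact big (card_le_two_mul_addOrderOf_of_mod_one_law_card_four hρρ hρτ hτρ hττ hρ hτ hne hsurj hmod hA14 h hV (by rw [eT, h2]))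
    · -- (2,3,18)
      exact big (card_le_two_mul_addOrderOf_of_mod_one_law_card_four hρρ hρτ hτρ hττ hρ hτ hne hsurj hmod hA14 hUST hV_UST (by rw [eS, h1]))
    · -- (2,6,9)
      exact big (card_le_two_mul_addOrderOf_of_mod_one_law_card_four hρρ hρτ hτρ hττ hρ hτ hne hsurj hmod hA14 hUST hV_UST (by rw [eS, h1]))
    · -- (2,9,6)
      exact big (card_le_two_mul_addOrderOf_of_mod_one_law_card_four hρρ hρτ hτρ hττ hρ hτ hne hsurj hmod hA14 hUST hV_UST (by rw [eS, h1]))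
    · -- (2,18,3)
      exact big (card_le_two_mul_addOrderOf_of_mod_one_law_card_four hρρ hρτ hτρ hττ hρ hτ hne hsurj hmod hA14 hUST hV_UST (by rw [eS, h1]))
    · -- (2,27,2)
      exact big (card_le_two_mul_addOrderOf_of_mod_one_law_card_four hρρ hρτ hτρ hττ hρ hτ hne hsurj hmod hA14 hUST hV_UST (by rw [eS, h1]))
    · -- (2,54,1)
      exact big (card_le_two_mul_addOrderOf_of_mod_one_law_card_four hρρ hρτ hτρ hττ hρ hτ hne hsurj hmod hA14 hUST hV_UST (by rw [eS, h1]))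
    · -- (3,1,36)
      exact absurd hV (no_law_cube_two_parts_of_ordered 1 3 (fun h' hS₀ hS₁ hT₀ hT₁ hU'' hV'' => no_law_cube_1de_of_onto_z5z5 (Or.inl rfl) hρρ hρτ hτρ hττ hρ hτ hne hsurj projZ5Z65 projZ5Z65_surjective h' hS₀ hS₁ hT₀ hT₁ hU'' hV'') h hS' hT' hU'
        (Or.inr (Or.inr (Or.inr (Or.inl ⟨h1, h2⟩)))))
    · -- (3,2,18)
      exact big (card_le_two_mul_addOrderOf_of_mod_one_law_card_four hρρ hρτ hτρ hττ hρ hτ hne hsurj hmod hA14 h hV (by rw [eT, h2]))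
    · -- (3,3,12)
      exact absurd hV (no_law_cube_three_three_z5_z65 hρρ hρτ hτρ hττ hρ hτ hne hsurj h hS' hT' hU' (Or.inl ⟨h1, h2⟩))
    · -- (3,4,9)
      exact absurd hV (no_law_cube_three_four_z5_z65 hρρ hρτ hτρ hττ hρ hτ hne hsurj h hS' hT' hU' (Or.inl ⟨h1, h2⟩))
    · -- (3,6,6)
      exact absurd hV (no_law_cube_three_six_z5_z65 hρρ hρτ hτρ hττ hρ hτ hne hsurj h hS' hT' hU' (Or.inl ⟨h1, h2⟩))
    · -- (3,9,4)
      exact absurd hV (no_law_cube_three_four_z5_z65 hρρ hρτ hτρ hττ hρ hτ hne hsurj h hS' hT' hU' (Or.inr (Or.inr (Or.inr (Or.inr (Or.inr (⟨h3, h1⟩)))))))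
    · -- (3,12,3)
      exact absurd hV (no_law_cube_three_three_z5_z65 hρρ hρτ hτρ hττ hρ hτ hne hsurj h hS' hT' hU' (Or.inr (Or.inr (Or.inl ⟨h3, h1⟩))))
    · -- (3,18,2)
      exact big (card_le_two_mul_addOrderOf_of_mod_one_law_card_four hρρ hρτ hτρ hττ hρ hτ hne hsurj hmod hA14 hTUS hV_TUS (by rw [eU, h3]))
    · -- (3,36,1)
      exact absurd hV (no_law_cube_two_parts_of_ordered 1 3 (fun h' hS₀ hS₁ hT₀ hT₁ hU'' hV'' => no_law_cube_1de_of_onto_z5z5 (Or.inl rfl) hρρ hρτ hτρ hττ hρ hτ hne hsurj projZ5Z65 projZ5Z65_surjective h' hS₀ hS₁ hT₀ hT₁ hU'' hV'') h hS' hT' hU'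
        (Or.inr (Or.inr (Or.inl ⟨h3, h1⟩))))
    · -- (4,1,27)
      exact absurd hV (no_law_cube_two_parts_of_ordered 1 4 (fun h' hS₀ hS₁ hT₀ hT₁ hU'' hV'' => no_law_cube_1de_of_onto_z5z5 (Or.inr rfl) hρρ hρτ hτρ hττ hρ hτ hne hsurj projZ5Z65 projZ5Z65_surjective h' hS₀ hS₁ hT₀ hT₁ hU'' hV'') h hS' hT' hU'
        (Or.inr (Or.inr (Or.inr (Or.inl ⟨h1, h2⟩)))))
    · -- (4,3,9)
      exact absurd hV (no_law_cube_three_four_z5_z65 hρρ hρτ hτρ hττ hρ hτ hne hsurj h hS' hT' hU' (Or.inr (Or.inr (Or.inr (Or.inl ⟨h1, h2⟩)))))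
    · -- (4,9,3)
      exact absurd hV (no_law_cube_three_four_z5_z65 hρρ hρτ hτρ hττ hρ hτ hne hsurj h hS' hT' hU' (Or.inr (Or.inr (Or.inl ⟨h3, h1⟩))))
    · -- (4,27,1)
      exact absurd hV (no_law_cube_two_parts_of_ordered 1 4 (fun h' hS₀ hS₁ hT₀ hT₁ hU'' hV'' => no_law_cube_1de_of_onto_z5z5 (Or.inr rfl) hρρ hρτ hτρ hττ hρ hτ hne hsurj projZ5Z65 projZ5Z65_surjective h' hS₀ hS₁ hT₀ hT₁ hU'' hV'') h hS' hT' hU'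
        (Or.inr (Or.inr (Or.inl ⟨h3, h1⟩))))
    · -- (6,1,18)
      exact absurd hV (no_law_cube_two_parts_of_ordered 1 6 (fun h' hS₀ hS₁ hT₀ hT₁ hU'' hV'' => no_law_cube_1de6_of_onto_z5z5 rfl hρρ hρτ hτρ hττ hρ hτ hne hsurj projZ5Z65 projZ5Z65_surjective h' hS₀ hS₁ hT₀ hT₁ hU'' hV'') h hS' hT' hU'
        (Or.inr (Or.inr (Or.inr (Or.inl ⟨h1, h2⟩)))))
    · -- (6,2,9)
      exact big (card_le_two_mul_addOrderOf_of_mod_one_law_card_four hρρ hρτ hτρ hττ hρ hτ hne hsurj hmod hA14 h hV (by rw [eT, h2]))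
    · -- (6,3,6)
      exact absurd hV (no_law_cube_three_six_z5_z65 hρρ hρτ hτρ hττ hρ hτ hne hsurj h hS' hT' hU' (Or.inr (Or.inl ⟨h2, h3⟩)))
    · -- (6,6,3)
      exact absurd hV (no_law_cube_three_six_z5_z65 hρρ hρτ hτρ hττ hρ hτ hne hsurj h hS' hT' hU' (Or.inr (Or.inr (Or.inl ⟨h3, h1⟩))))
    · -- (6,9,2)
      exact big (card_le_two_mul_addOrderOf_of_mod_one_law_card_four hρρ hρτ hτρ hττ hρ hτ hne hsurj hmod hA14 hTUS hV_TUS (by rw [eU, h3]))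
    · -- (6,18,1)
      exact absurd hV (no_law_cube_two_parts_of_ordered 1 6 (fun h' hS₀ hS₁ hT₀ hT₁ hU'' hV'' => no_law_cube_1de6_of_onto_z5z5 rfl hρρ hρτ hτρ hττ hρ hτ hne hsurj projZ5Z65 projZ5Z65_surjective h' hS₀ hS₁ hT₀ hT₁ hU'' hV'') h hS' hT' hU'
        (Or.inr (Or.inr (Or.inl ⟨h3, h1⟩))))
    · -- (9,1,12)
      exact absurd hV (no_law_cube_one_nine_z5_z65 hρρ hρτ hτρ hττ hρ hτ hne hsurj h hS' hT' hU' (Or.inr (Or.inr (Or.inr (Or.inl ⟨h1, h2⟩)))))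
    · -- (9,2,6)
      exact big (card_le_two_mul_addOrderOf_of_mod_one_law_card_four hρρ hρτ hτρ hττ hρ hτ hne hsurj hmod hA14 h hV (by rw [eT, h2]))
    · -- (9,3,4)
      exact absurd hV (no_law_cube_three_four_z5_z65 hρρ hρτ hτρ hττ hρ hτ hne hsurj h hS' hT' hU' (Or.inr (Or.inl ⟨h2, h3⟩)))
    · -- (9,4,3)
      exact absurd hV (no_law_cube_three_four_z5_z65 hρρ hρτ hτρ hττ hρ hτ hne hsurj h hS' hT' hU' (Or.inr (Or.inr (Or.inr (Or.inr (Or.inl ⟨h2, h3⟩))))))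
    · -- (9,6,2)
      exact big (card_le_two_mul_addOrderOf_of_mod_one_law_card_four hρρ hρτ hτρ hττ hρ hτ hne hsurj hmod hA14 hTUS hV_TUS (by rw [eU, h3]))
    · -- (9,12,1)
      exact absurd hV (no_law_cube_one_nine_z5_z65 hρρ hρτ hτρ hττ hρ hτ hne hsurj h hS' hT' hU' (Or.inr (Or.inr (Or.inl ⟨h3, h1⟩))))
    · -- (12,1,9)
      exact absurd hV (no_law_cube_one_nine_z5_z65 hρρ hρτ hτρ hττ hρ hτ hne hsurj h hS' hT' hU' (Or.inr (Or.inl ⟨h2, h3⟩)))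
    · -- (12,3,3)
      exact absurd hV (no_law_cube_three_three_z5_z65 hρρ hρτ hτρ hττ hρ hτ hne hsurj h hS' hT' hU' (Or.inr (Or.inl ⟨h2, h3⟩)))
    · -- (12,9,1)
      exact absurd hV (no_law_cube_one_nine_z5_z65 hρρ hρτ hτρ hττ hρ hτ hne hsurj h hS' hT' hU' (Or.inr (Or.inr (Or.inr (Or.inr (Or.inl ⟨h2, h3⟩))))))
    · -- (18,1,6)
      exact absurd hV (no_law_cube_two_parts_of_ordered 1 6 (fun h' hS₀ hS₁ hT₀ hT₁ hU'' hV'' => no_law_cube_1de6_of_onto_z5z5 rfl hρρ hρτ hτρ hττ hρ hτ hne hsurj projZ5Z65 projZ5Z65_surjective h' hS₀ hS₁ hT₀ hT₁ hU'' hV'') h hS' hT' hU'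
        (Or.inr (Or.inl ⟨h2, h3⟩)))
    · -- (18,2,3)
      exact big (card_le_two_mul_addOrderOf_of_mod_one_law_card_four hρρ hρτ hτρ hττ hρ hτ hne hsurj hmod hA14 h hV (by rw [eT, h2]))
    · -- (18,3,2)
      exact big (card_le_two_mul_addOrderOf_of_mod_one_law_card_four hρρ hρτ hτρ hττ hρ hτ hne hsurj hmod hA14 hTUS hV_TUS (by rw [eU, h3]))
    · -- (18,6,1)
      exact absurd hV (no_law_cube_two_parts_of_ordered 1 6 (fun h' hS₀ hS₁ hT₀ hT₁ hU'' hV'' => no_law_cube_1de6_of_onto_z5z5 rfl hρρ hρτ hτρ hττ hρ hτ hne hsurj projZ5Z65 projZ5Z65_surjective h' hS₀ hS₁ hT₀ hT₁ hU'' hV'') h hS' hT' hU'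
        (Or.inr (Or.inr (Or.inr (Or.inr (Or.inl ⟨h2, h3⟩))))))
    · -- (27,1,4)
      exact absurd hV (no_law_cube_two_parts_of_ordered 1 4 (fun h' hS₀ hS₁ hT₀ hT₁ hU'' hV'' => no_law_cube_1de_of_onto_z5z5 (Or.inr rfl) hρρ hρτ hτρ hττ hρ hτ hne hsurj projZ5Z65 projZ5Z65_surjective h' hS₀ hS₁ hT₀ hT₁ hU'' hV'') h hS' hT' hU'
        (Or.inr (Or.inl ⟨h2, h3⟩)))
    · -- (27,2,2)
      exact big (card_le_two_mul_addOrderOf_of_mod_one_law_card_four hρρ hρτ hτρ hττ hρ hτ hne hsurj hmod hA14 h hV (by rw [eT, h2]))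
    · -- (27,4,1)
      exact absurd hV (no_law_cube_two_parts_of_ordered 1 4 (fun h' hS₀ hS₁ hT₀ hT₁ hU'' hV'' => no_law_cube_1de_of_onto_z5z5 (Or.inr rfl) hρρ hρτ hτρ hττ hρ hτ hne hsurj projZ5Z65 projZ5Z65_surjective h' hS₀ hS₁ hT₀ hT₁ hU'' hV'') h hS' hT' hU'
        (Or.inr (Or.inr (Or.inr (Or.inr (Or.inl ⟨h2, h3⟩))))))
    · -- (36,1,3)
      exact absurd hV (no_law_cube_two_parts_of_ordered 1 3 (fun h' hS₀ hS₁ hT₀ hT₁ hU'' hV'' => no_law_cube_1de_of_onto_z5z5 (Or.inl rfl) hρρ hρτ hτρ hττ hρ hτ hne hsurj projZ5Z65 projZ5Z65_surjective h' hS₀ hS₁ hT₀ hT₁ hU'' hV'') h hS' hT' hU'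
        (Or.inr (Or.inl ⟨h2, h3⟩)))
    · -- (36,3,1)
      exact absurd hV (no_law_cube_two_parts_of_ordered 1 3 (fun h' hS₀ hS₁ hT₀ hT₁ hU'' hV'' => no_law_cube_1de_of_onto_z5z5 (Or.inl rfl) hρρ hρτ hτρ hττ hρ hτ hne hsurj projZ5Z65 projZ5Z65_surjective h' hS₀ hS₁ hT₀ hT₁ hU'' hV'') h hS' hT' hU'
        (Or.inr (Or.inr (Or.inr (Or.inr (Or.inl ⟨h2, h3⟩))))))
    · -- (54,1,2)
      exact big (card_le_two_mul_addOrderOf_of_mod_one_law_card_four hρρ hρτ hτρ hττ hρ hτ hne hsurj hmod hA14 hTUS hV_TUS (by rw [eU, h3]))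
    · -- (54,2,1)
      exact big (card_le_two_mul_addOrderOf_of_mod_one_law_card_four hρρ hρτ hτρ hττ hρ hτ hne hsurj hmod hA14 h hV (by rw [eT, h2]))
    · -- (108,1,1)
      exact big (card_le_two_mul_addOrderOf_of_two_two_law hρρ hρτ hτρ hττ hρ hτ hne hsurj hmod hA7 hTUS (by rw [eT, h2]) (by rw [eU, h3]) hV_TUS)
  · obtain ⟨g, a, b, hab⟩ :=
      two_cosets_of_mod_one_law_of_not_cube hρρ hρτ hτρ hττ hρ hτ hne hsurj hmod hA14 h hV hnc
    exact big ⟨g, card_le_two_mul_addOrderOf_of_two_cosets hab⟩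

end DihedralLike

end Summit.MatrixMultiplication.OmegaCensus
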